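import Literature.NumberTheory.Automorphic.ArchRankOneSplitOrbitContinuity     -- ★ (A0-b) p850189 (F0P3a-p05 (g19)): `hypBlockGL_mem_of_eq_over`, the cone value shape of `tendsto_abs_sub_smul_integral_descConj_hypBlockGL`
import Literature.NumberTheory.Automorphic.ArchEndoscopicChartOrbLocalPos      -- ★ (N2) p850271 §3 (LH5-p04 (g2)): `smul_integral_prod_conj_ofReal_ne_zero_of_nonneg` (the `K × N` cone integral of a non-negative function is positive)
import Literature.NumberTheory.Automorphic.ArchRankOneSplitIwasawa              -- ★ (IWA) p850256 (F0P3a-p05 (g19)): the circle `K₁`, `U(Φ₂)(ℂ) = K₁·B`, `isHaarMeasure_map_rotLift` (ED. 3 §4)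
import HarnessLib

/-!
# The (A0) cone value `C • ∫_{K×N} F(e^{iθ}·k n k⁻¹)` is NON-ZERO for a real non-negative `F` positive at the vertex — (NONDEG-G′) piece 2a
# (Varadarajan 1989 §6.4 Thm 23; Shelstad 1979 Lemma 4.3; Rogawski 1990 §8.2)

Topic `NumberTheory/Automorphic`; namespaces `Literature.NumberTheory.Automorphic` (§1, group-generic) and `….UnitaryGroup` (§2, the `U(Φ₂)(ℂ)` split chart of ★ (A0-b)).
THEOREMS ONLY (no definition, no instance, no notation, no axiom, no named fact, no `sorry`).  Cell `pub/hodgecm-mathlib`, crux H413 (`stmt-HodgeConjecture-24833`), F0∕P3c line LH3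
(closer stub `stub_N9`, DIRECT ROAD N9″, organ J), brick **(NONDEG-G′)** (LH3-plan (g3) 2026-09-02T07:46:17Z → F0P3b-p01 (g15)), piece 2a = the SHAPE-INDEPENDENT half of the
assembly: whatever the (G′-CAY) chain (D4b(β) + (M-UNFOLD) + (A0-b∕c)) makes of the block reading `F` of the descended test function `(a′)_M`, the Cayley value is the (A0-b) limit
`(C : ℝ) • ∫_{K × N} F(z · k n k⁻¹) d(κ ⊗ μ_N)`, `z = hypBlockGL 0 θ` central, `C ≠ 0` (★ `exists_measure_quotient_torusU_complex_two_eq_smul_map`); this file shows that value is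
NON-ZERO as soon as `F` is continuous, compactly supported, REAL NON-NEGATIVE in the `ℂ`-valued currency of ★ (N1′) `exists_archSmooth_nonneg_ne_zero_at` and of ★ piece 1
`exists_descended_forall_orbitalIntegral_eq_nonneg` (`0 ≤ re F`, `im F = 0`), and POSITIVE AT THE VERTEX `z` (`0 < re F z`) — by rewriting `F = ofReal ∘ re ∘ F` and quoting
★ (N2) §3 (the integrand is continuous, non-negative, compactly supported on `K × N`, and equals `re F z > 0` at `(k, n) = (1, 1)`; `κ`, `μ_N` charge open sets).

* §1 `smul_integral_prod_conj_ne_zero_of_re_nonneg` — generic `K, N ≤ G` (`K` compact, `N` closed), measures finite on compacta charging open sets, `C ≠ 0`, `F : G → ℂ` as above.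
* §2 `smul_integral_prod_conj_hypBlockGL_ne_zero_of_re_nonneg` — the instance on `U(J)`, `hJ : J = (StdForm.antidiagonal 2).over ℂ`, `N = unipotentU`, `K` any compact subgroup,
  `κ`, `μ_N` Haar, `z = ⟨hypBlockGL 0 θ, _⟩`: TOKEN-IDENTICAL to the limit value of ★ `tendsto_abs_sub_smul_integral_descConj_hypBlockGL` (so (NONDEG-G′) piece 2b closes by
  `exact` once the (G′-CAY) chain names `F`).
HONEST LABEL: HC_CM is proved only modulo the 7 printed citations (2 remaining named inputs: hLiu418 = `stmt-HodgeConjecture-24832`, h413 = `stmt-HodgeConjecture-24833`) until rung 0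
closes; count-neutral positivity bookkeeping, pays nothing by itself.

## References
* [Varadarajan1989] V. S. Varadarajan, *An Introduction to Harmonic Analysis on Semisimple Lie Groups*, Cambridge Stud. Adv. Math. 16 (1989), §6.4 Thm 23 (Rao's cone integral as the
  limit of normalised orbital integrals).
* [Shelstad1979] D. Shelstad, *Characters and inner forms of a quasi-split group over ℝ*, Compositio Math. 39 (1979) 11–45, §4 Lemma 4.3 p. 25.
* [Rogawski1990] J. D. Rogawski, *Automorphic Representations of Unitary Groups in Three Variables*, Ann. of Math. Stud. 123 (1990), §8.2 pp. 118–124.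
-/

set_option autoImplicit false

noncomputable section

open MeasureTheory MeasureTheory.Measure Set Filter Topology Function
open scoped ENNReal NNReal

namespace Literature.NumberTheory.Automorphic

/-! ## §1 Generic: the `K × N` cone integral of a real non-negative `ℂ`-valued function positive at the vertex is non-zero -/

section Generic

variable {G : Type*} [Group G] [TopologicalSpace G] [IsTopologicalGroup G]
  (K N : Subgroup G) (hK : IsCompact (K : Set G)) (hN : IsClosed (N : Set G))
  [SecondCountableTopology G] [MeasurableSpace ↥K] [BorelSpace ↥K] [MeasurableSpace ↥N] [BorelSpace ↥N]
  (κ : Measure ↥K) (μN : Measure ↥N) [IsFiniteMeasureOnCompacts κ] [IsFiniteMeasureOnCompacts μN] [κ.IsOpenPosMeasure] [μN.IsOpenPosMeasure] [SFinite μN]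

include hK hN in
/-- **The cone value of a REAL NON-NEGATIVE `ℂ`-valued function positive at the vertex is non-zero**: for `K` compact, `N` closed, `κ`, `μ_N` finite on compacta and charging
open sets, `C ≠ 0`, and `F : G → ℂ` continuous, compactly supported with `0 ≤ re F`, `im F = 0` everywhere and `0 < re F(z)`:
`C • ∫_{K × N} F(z · k n k⁻¹) d(κ ⊗ μ_N) ≠ 0` (★ `smul_integral_prod_conj_ofReal_ne_zero_of_nonneg` applied to `re ∘ F`, since `F = ofReal ∘ re ∘ F`).
[cite: Varadarajan1989, §6.4 Thm 23] [cite: Shelstad1979, Lemma 4.3 p. 25] -/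
theorem smul_integral_prod_conj_ne_zero_of_re_nonneg {C : ℝ} (hC : C ≠ 0) (z : G) {F : G → ℂ} (hF : Continuous F) (hFc : HasCompactSupport F)
    (h0 : ∀ g, 0 ≤ (F g).re ∧ (F g).im = 0) (hz : 0 < (F z).re) :
    C • ∫ p : ↥K × ↥N, F (z * ((p.1 : G) * (p.2 : G) * (p.1 : G)⁻¹)) ∂(κ.prod μN) ≠ 0 := by
  -- `F` is the `ofReal`-cast of its real part `f`
  set f : G → ℝ := fun g => (F g).re with hfdef
  have hFeq : ∀ g, F g = ((f g : ℝ) : ℂ) := fun g => Complex.ext (by simp [hfdef]) (by simp [hfdef, (h0 g).2])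
  have hint : (fun p : ↥K × ↥N => F (z * ((p.1 : G) * (p.2 : G) * (p.1 : G)⁻¹))) =
      fun p : ↥K × ↥N => ((f (z * ((p.1 : G) * (p.2 : G) * (p.1 : G)⁻¹)) : ℝ) : ℂ) :=
    funext fun p => hFeq _
  rw [hint]
  exact smul_integral_prod_conj_ofReal_ne_zero_of_nonneg K N hK hN κ μN hC z (Complex.continuous_re.comp hF)
    (hFc.comp_left Complex.zero_re) (fun g => (h0 g).1) hz.ne'

end Generic

/-! ## §2 The `U(Φ₂)(ℂ)` split chart: the (A0-b) cone value is non-zero -/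

namespace UnitaryGroup

section SplitChart

open Literature.NumberTheory.Rogawski1990 Literature.NumberTheory.Automorphic.UnitaryGroup.LineRing

variable {J : Matrix (Fin 2) (Fin 2) ℂ} (hJ : J = (StdForm.antidiagonal 2).over ℂ)
  [MeasurableSpace ↥(unitaryGroupOfForm (starRingEnd ℂ) J)] [BorelSpace ↥(unitaryGroupOfForm (starRingEnd ℂ) J)]
  {K : Subgroup ↥(unitaryGroupOfForm (starRingEnd ℂ) J)} (hK : IsCompact (K : Set ↥(unitaryGroupOfForm (starRingEnd ℂ) J)))
  (κ : Measure ↥K) (μN : Measure ↥(unipotentU (starRingEnd ℂ) J)) [IsHaarMeasure κ] [IsHaarMeasure μN]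

include hJ hK in
/-- **(NONDEG-G′) piece 2a — THE (A0) CONE VALUE IS NON-ZERO** for a real non-negative `ℂ`-valued test function positive at the vertex: with the tokens of ★
`tendsto_abs_sub_smul_integral_descConj_hypBlockGL` (`K ≤ U(Φ₂)(ℂ)` compact, `κ`, `μ_N` Haar on `K` and on `N = unipotentU`, `C ≠ 0` from ★
`exists_measure_quotient_torusU_complex_two_eq_smul_map`, vertex `z = hypBlockGL 0 θ = e^{iθ}·1`), if `F : U(Φ₂)(ℂ) → ℂ` is continuous, compactly supported,
`0 ≤ re F`, `im F = 0`, and `0 < re F(z)`, then `(C : ℝ) • ∫_{K × N} F(z · k n k⁻¹) d(κ ⊗ μ_N) ≠ 0`.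
[cite: Varadarajan1989, §6.4 Thm 23] [cite: Shelstad1979, Lemma 4.3 p. 25] [cite: Rogawski1990, §8.2 p. 122] -/
theorem smul_integral_prod_conj_hypBlockGL_ne_zero_of_re_nonneg {C : ℝ≥0} (hC : C ≠ 0)
    (F : ↥(unitaryGroupOfForm (starRingEnd ℂ) J) → ℂ) (hF : Continuous F) (hFc : HasCompactSupport F)
    (h0 : ∀ g, 0 ≤ (F g).re ∧ (F g).im = 0) (θ : ℝ)
    (hz : 0 < (F (⟨hypBlockGL 0 θ, hypBlockGL_mem_of_eq_over hJ 0 θ⟩ : ↥(unitaryGroupOfForm (starRingEnd ℂ) J))).re) :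
    (C : ℝ) • ∫ p : ↥K × ↥(unipotentU (starRingEnd ℂ) J),
        F ((⟨hypBlockGL 0 θ, hypBlockGL_mem_of_eq_over hJ 0 θ⟩ : ↥(unitaryGroupOfForm (starRingEnd ℂ) J)) *
          ((p.1 : ↥(unitaryGroupOfForm (starRingEnd ℂ) J)) * (p.2 : ↥(unitaryGroupOfForm (starRingEnd ℂ) J)) *
            (p.1 : ↥(unitaryGroupOfForm (starRingEnd ℂ) J))⁻¹)) ∂(κ.prod μN) ≠ 0 := by
  haveI : SecondCountableTopology ↥(unitaryGroupOfForm (starRingEnd ℂ) J) := secondCountableTopology_unitaryGroupOfForm_complex J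
  haveI : LocallyCompactSpace ↥(unitaryGroupOfForm (starRingEnd ℂ) J) := locallyCompactSpace_unitaryGroupOfForm_complex J
  haveI : SecondCountableTopology ↥(unipotentU (starRingEnd ℂ) J) := TopologicalSpace.Subtype.secondCountableTopology _
  have hN : IsClosed (unipotentU (starRingEnd ℂ) J : Set ↥(unitaryGroupOfForm (starRingEnd ℂ) J)) := isClosed_unipotentU _ _
  haveI : LocallyCompactSpace ↥(unipotentU (starRingEnd ℂ) J) := hN.isClosedEmbedding_subtypeVal.locallyCompactSpace
  haveI : SigmaFinite μN := by infer_instance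
  have hC' : (C : ℝ) ≠ 0 := NNReal.coe_ne_zero.2 hC
  exact smul_integral_prod_conj_ne_zero_of_re_nonneg K (unipotentU (starRingEnd ℂ) J) hK hN κ μN hC' _ hF hFc h0 hz

end SplitChart

end UnitaryGroup

end Literature.NumberTheory.Automorphic

end

/-! ## §3 (EDITION 2, append-only) The cone value of a function READ THROUGH A CLOSED EMBEDDING of the block — the shape (NONDEG-G′) piece 2b consumes
(the block reading `F = ψ_M ∘ ι` of the descended test function along the block embedding `ι : U(Φ₂)(ℂ) → Z(s)` of (M-UNFOLD)) -/

noncomputable section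

namespace Literature.NumberTheory.Automorphic.UnitaryGroup

-- inside `namespace Literature.…` the directory namespaces `Literature.MeasureTheory` ∕ `Literature.Topology` shadow Mathlib's: open the root ones (CONVENTIONS §2)
open _root_.MeasureTheory _root_.MeasureTheory.Measure Set Filter _root_.Topology Function
open Literature.NumberTheory.Rogawski1990 Literature.NumberTheory.Automorphic.UnitaryGroup.LineRing
open scoped ENNReal NNReal

section SplitChartComp

variable {J : Matrix (Fin 2) (Fin 2) ℂ} (hJ : J = (StdForm.antidiagonal 2).over ℂ)
  [MeasurableSpace ↥(unitaryGroupOfForm (starRingEnd ℂ) J)] [BorelSpace ↥(unitaryGroupOfForm (starRingEnd ℂ) J)]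
  {K : Subgroup ↥(unitaryGroupOfForm (starRingEnd ℂ) J)} (hK : IsCompact (K : Set ↥(unitaryGroupOfForm (starRingEnd ℂ) J)))
  (κ : Measure ↥K) (μN : Measure ↥(unipotentU (starRingEnd ℂ) J)) [IsHaarMeasure κ] [IsHaarMeasure μN]

include hJ hK in
/-- **(NONDEG-G′) piece 2b, ABSTRACT BLOCK EMBEDDING.**  Let `ψ : X → ℂ` be continuous, compactly supported, real non-negative (`0 ≤ re ψ`, `im ψ = 0` — the export of ★
`exists_descended_forall_orbitalIntegral_eq_nonneg` for the descended `(a′)_M`), and `ι : U(Φ₂)(ℂ) → X` a CLOSED EMBEDDING (the block inclusion of (M-UNFOLD)) sending the vertex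
`hypBlockGL 0 θ` to a point where `0 < re ψ` (the semi-regular wall point `s`, central in `Z(s)`).  Then the (A0) cone value of the block reading `ψ ∘ ι` is non-zero:
`(C : ℝ) • ∫_{K × N} ψ(ι(z · k n k⁻¹)) d(κ ⊗ μ_N) ≠ 0` for `C ≠ 0`.  (Compact support of `ψ ∘ ι`: Mathlib `HasCompactSupport.comp_isClosedEmbedding`.)
[cite: Varadarajan1989, §6.4 Thm 23] [cite: Shelstad1979, Lemma 4.3 p. 25] [cite: Rogawski1990, §8.2 p. 122] -/
theorem smul_integral_prod_conj_hypBlockGL_comp_ne_zero_of_re_nonneg {C : ℝ≥0} (hC : C ≠ 0)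
    {X : Type*} [TopologicalSpace X] {ψ : X → ℂ} (hψ : Continuous ψ) (hψc : HasCompactSupport ψ) (hψ0 : ∀ x, 0 ≤ (ψ x).re ∧ (ψ x).im = 0)
    {ι : ↥(unitaryGroupOfForm (starRingEnd ℂ) J) → X} (hι : IsClosedEmbedding ι) (θ : ℝ)
    (hpos : 0 < (ψ (ι (⟨hypBlockGL 0 θ, hypBlockGL_mem_of_eq_over hJ 0 θ⟩ : ↥(unitaryGroupOfForm (starRingEnd ℂ) J)))).re) :
    (C : ℝ) • ∫ p : ↥K × ↥(unipotentU (starRingEnd ℂ) J),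
        ψ (ι ((⟨hypBlockGL 0 θ, hypBlockGL_mem_of_eq_over hJ 0 θ⟩ : ↥(unitaryGroupOfForm (starRingEnd ℂ) J)) *
          ((p.1 : ↥(unitaryGroupOfForm (starRingEnd ℂ) J)) * (p.2 : ↥(unitaryGroupOfForm (starRingEnd ℂ) J)) *
            (p.1 : ↥(unitaryGroupOfForm (starRingEnd ℂ) J))⁻¹))) ∂(κ.prod μN) ≠ 0 :=
  smul_integral_prod_conj_hypBlockGL_ne_zero_of_re_nonneg hJ hK κ μN hC (ψ ∘ ι) (hψ.comp hι.continuous) (hψc.comp_isClosedEmbedding hι)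
    (fun g => hψ0 (ι g)) θ hpos

end SplitChartComp

end Literature.NumberTheory.Automorphic.UnitaryGroup

end

/-! ## §4 (EDITION 3, append-only) CURRENCY-FREE: the (A0) limit of a real non-negative test function positive at the vertex EXISTS and is NON-ZERO, for EVERY
non-zero invariant Radon measure on `U(Φ₂)(ℂ) ⧸ T` — so ANY stated value of that limit (the `K × N` value of ★ (A0-b), the half-cone value `C₂ • (cone⁺ + cone⁻)` of ★ (A0-c) ∕
the shared rank-one datum `SharedA0`) is non-zero by uniqueness of limits -/

noncomputable section

namespace Literature.NumberTheory.Automorphic.UnitaryGroup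

open _root_.MeasureTheory _root_.MeasureTheory.Measure Set Filter _root_.Topology Function
open Literature.NumberTheory.Rogawski1990 Literature.NumberTheory.Automorphic.UnitaryGroup.LineRing
open scoped ENNReal NNReal Real

section CurrencyFree

open Literature.MeasureTheory.Group

variable {J : Matrix (Fin 2) (Fin 2) ℂ} (hJ : J = (StdForm.antidiagonal 2).over ℂ)
  [MeasurableSpace ↥(unitaryGroupOfForm (starRingEnd ℂ) J)] [BorelSpace ↥(unitaryGroupOfForm (starRingEnd ℂ) J)]
  [MeasurableSpace (↥(unitaryGroupOfForm (starRingEnd ℂ) J) ⧸ torusU (starRingEnd ℂ) J)] [BorelSpace (↥(unitaryGroupOfForm (starRingEnd ℂ) J) ⧸ torusU (starRingEnd ℂ) J)]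
  (μ : Measure (↥(unitaryGroupOfForm (starRingEnd ℂ) J) ⧸ torusU (starRingEnd ℂ) J))
  [SMulInvariantMeasure ↥(unitaryGroupOfForm (starRingEnd ℂ) J) (↥(unitaryGroupOfForm (starRingEnd ℂ) J) ⧸ torusU (starRingEnd ℂ) J) μ] [IsFiniteMeasureOnCompacts μ]

include hJ in
/-- **THE (A0) LIMIT OF A REAL NON-NEGATIVE TEST FUNCTION POSITIVE AT THE VERTEX EXISTS AND IS NON-ZERO** — currency-free form: for every non-zero invariant Radon measure `μ`
on `U(Φ₂)(ℂ) ⧸ T` and `F ∈ C_c(U(Φ₂)(ℂ))` with `0 ≤ re F`, `im F = 0`, `0 < re F(e^{iθ}·1)`, there is `V ≠ 0` with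
`|eˣ − e⁻ˣ| • ∫_{G⧸T} F(y · hypBlockGL x θ · y⁻¹) dμ(ẏ) → V` as `x → 0`, `x ≠ 0` (the Iwasawa circle `K₁` of ★ (IWA), Haar measures on `K₁`, `N`, `T`, the Iwasawa form `μ = C • π_*(κ ⊗ μ_N)`
of ★ `exists_measure_quotient_torusU_complex_two_eq_smul_map` with `C ≠ 0`, the limit ★ (A0-b) `tendsto_abs_sub_smul_integral_descConj_hypBlockGL`, and `V ≠ 0` by §2).
[cite: Varadarajan1989, §6.4 Lemma 21, Thm 23] [cite: Shelstad1979, Lemma 4.3 p. 25] [cite: Rogawski1990, §8.2 p. 119] -/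
theorem exists_ne_zero_tendsto_abs_sub_smul_integral_descConj_hypBlockGL_of_re_nonneg [Fact (0 < 2 * π)] (hμ : μ ≠ 0)
    {F : ↥(unitaryGroupOfForm (starRingEnd ℂ) J) → ℂ} (hF : Continuous F) (hFc : HasCompactSupport F) (h0 : ∀ g, 0 ≤ (F g).re ∧ (F g).im = 0) (θ : ℝ)
    (hz : 0 < (F ((⟨hypBlockGL 0 θ, hypBlockGL_mem_of_eq_over hJ 0 θ⟩ : ↥(unitaryGroupOfForm (starRingEnd ℂ) J)))).re) :
    ∃ V : ℂ, V ≠ 0 ∧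
      Tendsto (fun x : ℝ => |Real.exp x - Real.exp (-x)| •
          ∫ y, descConj ((⟨hypBlockGL x θ, hypBlockGL_mem_of_eq_over hJ x θ⟩ : ↥(unitaryGroupOfForm (starRingEnd ℂ) J))) (torusU (starRingEnd ℂ) J)
            (LineRing.forall_mem_torusU_comm (starRingEnd ℂ) J (hypBlockGL_mem_torusU hJ x θ)) F y ∂μ)
        (𝓝[≠] 0) (𝓝 V) := by
  -- instances on `G`, `T`, `N`
  haveI : LocallyCompactSpace ↥(unitaryGroupOfForm (starRingEnd ℂ) J) := locallyCompactSpace_unitaryGroupOfForm_complex J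
  haveI : SecondCountableTopology ↥(unitaryGroupOfForm (starRingEnd ℂ) J) := secondCountableTopology_unitaryGroupOfForm_complex J
  have hT : IsClosed (torusU (starRingEnd ℂ) J : Set ↥(unitaryGroupOfForm (starRingEnd ℂ) J)) := isClosed_torusU_two _ _
  have hN : IsClosed (unipotentU (starRingEnd ℂ) J : Set ↥(unitaryGroupOfForm (starRingEnd ℂ) J)) := isClosed_unipotentU _ _
  haveI : LocallyCompactSpace ↥(torusU (starRingEnd ℂ) J) := hT.isClosedEmbedding_subtypeVal.locallyCompactSpace
  haveI : LocallyCompactSpace ↥(unipotentU (starRingEnd ℂ) J) := hN.isClosedEmbedding_subtypeVal.locallyCompactSpace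
  haveI : SecondCountableTopology ↥(unipotentU (starRingEnd ℂ) J) := TopologicalSpace.Subtype.secondCountableTopology _
  haveI : BorelSpace ↥(torusU (starRingEnd ℂ) J) := Subtype.borelSpace _
  haveI : BorelSpace ↥(unipotentU (starRingEnd ℂ) J) := Subtype.borelSpace _
  -- the circle `K₁` as a subgroup, compact, with `G = K₁ · B` (as in ★ `exists_tendsto_abs_sub_smul_integral_descConj_hypBlockGL_cone`)
  set ι : AddCircle (2 * π) → ↥(unitaryGroupOfForm (starRingEnd ℂ) J) :=
    fun s => ⟨archPlaneLiftGL 1 (rotMat s) (det_rotMat s), archPlaneLiftGL_rotMat_mem hJ s⟩ with hι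
  have hιadd : ∀ s t, ι (s + t) = ι s * ι t := fun s t => Subtype.ext (archPlaneLiftGL_rotMat_add s t)
  have hι0 : ι 0 = 1 := Subtype.ext archPlaneLiftGL_rotMat_zero
  have hιneg : ∀ s, ι (-s) = (ι s)⁻¹ := fun s => Subtype.ext (by
    rw [Subgroup.coe_inv]; exact archPlaneLiftGL_rotMat_neg s)
  let K : Subgroup ↥(unitaryGroupOfForm (starRingEnd ℂ) J) :=
    { carrier := Set.range ι
      one_mem' := ⟨0, hι0⟩
      mul_mem' := by
        rintro _ _ ⟨s, rfl⟩ ⟨t, rfl⟩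
        exact ⟨s + t, hιadd s t⟩
      inv_mem' := by
        rintro _ ⟨s, rfl⟩
        exact ⟨-s, hιneg s⟩ }
  have hKmem : ∀ s, ι s ∈ K := fun s => ⟨s, rfl⟩
  have hKmem' : ∀ k ∈ K, ∃ s, k = ι s := fun k ⟨s, hs⟩ => ⟨s, hs.symm⟩
  have hK : IsCompact (K : Set ↥(unitaryGroupOfForm (starRingEnd ℂ) J)) := isCompact_range_rotLift hJ
  have hKB : ∀ g : ↥(unitaryGroupOfForm (starRingEnd ℂ) J), ∃ k ∈ K, ∃ b ∈ borelU (starRingEnd ℂ) J, g = k * b := by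
    intro g
    obtain ⟨s, b, hb, hg⟩ := exists_rotLift_mul_mem_borelU hJ g
    exact ⟨ι s, hKmem s, b, hb, hg⟩
  haveI : CompactSpace ↥K := isCompact_iff_compactSpace.1 hK
  haveI : BorelSpace ↥K := Subtype.borelSpace _
  -- Haar measures: `κ` on `K₁` (image of `ds`), `μ_N` on `N`, `α` on `T`
  set ι' : AddCircle (2 * π) → ↥K := fun s => ⟨ι s, hKmem s⟩ with hι'
  set κ : Measure ↥K := Measure.map ι' volume with hκ
  haveI hκH : IsHaarMeasure κ := isHaarMeasure_map_rotLift hJ K hKmem hKmem'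
  set μN : Measure ↥(unipotentU (starRingEnd ℂ) J) := Measure.haar with hμN
  set α : Measure ↥(torusU (starRingEnd ℂ) J) := Measure.haar with hα
  -- ★ FILE 1: the Iwasawa form of `μ`, `C ≠ 0`
  obtain ⟨C, hC0, hμC⟩ := exists_measure_quotient_torusU_complex_two_eq_smul_map hJ hK hKB κ α μN μ hμ
  -- ★ (A0-b): the limit in `K × N` currency; §2: its value is non-zero
  exact ⟨_, smul_integral_prod_conj_hypBlockGL_ne_zero_of_re_nonneg hJ hK κ μN hC0 F hF hFc h0 θ hz,
    tendsto_abs_sub_smul_integral_descConj_hypBlockGL hJ κ μN μ hK hμC F hF hFc θ⟩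

include hJ in
/-- **ANY STATED VALUE OF THAT LIMIT IS NON-ZERO** (uniqueness of limits along a non-trivial filter below `𝓝[≠] 0`, e.g. `𝓝[>] 0`): if
`|eˣ − e⁻ˣ| • ∫_{G⧸T} F(y · hypBlockGL x θ · y⁻¹) dμ → V′` along `l ≤ 𝓝[≠] 0`, `l ≠ ⊥`, for `F` real non-negative positive at the vertex, then `V′ ≠ 0` — whatever currency `V′` is
written in (★ (A0-b)'s `C • ∫_{K×N}`, ★ (A0-c)'s `C₂ • (cone⁺ + cone⁻)`, the shared rank-one datum). [cite: Varadarajan1989, §6.4 Thm 23] [cite: Shelstad1979, Lemma 4.3 p. 25] -/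
theorem ne_zero_of_tendsto_abs_sub_smul_integral_descConj_hypBlockGL_of_re_nonneg [Fact (0 < 2 * π)] (hμ : μ ≠ 0)
    {F : ↥(unitaryGroupOfForm (starRingEnd ℂ) J) → ℂ} (hF : Continuous F) (hFc : HasCompactSupport F) (h0 : ∀ g, 0 ≤ (F g).re ∧ (F g).im = 0) (θ : ℝ)
    (hz : 0 < (F ((⟨hypBlockGL 0 θ, hypBlockGL_mem_of_eq_over hJ 0 θ⟩ : ↥(unitaryGroupOfForm (starRingEnd ℂ) J)))).re)
    {l : Filter ℝ} [l.NeBot] (hl : l ≤ 𝓝[≠] 0) {V' : ℂ}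
    (hV' : Tendsto (fun x : ℝ => |Real.exp x - Real.exp (-x)| •
          ∫ y, descConj ((⟨hypBlockGL x θ, hypBlockGL_mem_of_eq_over hJ x θ⟩ : ↥(unitaryGroupOfForm (starRingEnd ℂ) J))) (torusU (starRingEnd ℂ) J)
            (LineRing.forall_mem_torusU_comm (starRingEnd ℂ) J (hypBlockGL_mem_torusU hJ x θ)) F y ∂μ) l (𝓝 V')) :
    V' ≠ 0 := by
  obtain ⟨V, hV0, hV⟩ := exists_ne_zero_tendsto_abs_sub_smul_integral_descConj_hypBlockGL_of_re_nonneg hJ μ hμ hF hFc h0 θ hz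
  rw [tendsto_nhds_unique hV' (hV.mono_left hl)]
  exact hV0

end CurrencyFree

end Literature.NumberTheory.Automorphic.UnitaryGroup

end
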